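import Summits.QuantumFields.BalabanUV.T4Continuum.Support.B13StepOfRecordSecantStructural
import Summits.QuantumFields.BalabanUV.T4Continuum.Support.B13StepEnvelopeEnd

/-!
# NE5 ∕ U3 — the secant END of record E8[rec] FROM THE CAUCHY ROUTE's OPERATOR-SIDE BINDER: leaf-03's factor LINE-ANALYTICITY on
# the ball class (`B13TermOpEnvelope.ActOpLineAnalyticOn`) + room + the activity norm majorant, through leaf-03's BRIDGE
# `B13StepEnvelopeEnd.actOpFibre_of_actOpLineAnalyticOn` (⟹ the owner's fibre shape `ActOpFibre`) and this lineage's structural END —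
# so E8[rec] (secant) and E9[rec] (Cauchy) read ONE common operator-side binder

Cell `pub-balaban`, unit `b2b-balaban-t4-ne5-formalise-leaf-01` (NE5 formalisation swarm, LEAF PROVER 01, gen 5; journal INTENT
`B13StepOfRecordSecantLine` l.10495; leaf-03-g5's «MINE» on the bridge l.10528 honoured (ACK l.10619): the bridge lemma is leaf-03's
`B13StepEnvelopeEnd.actOpFibre_of_actOpLineAnalyticOn`, consumed here BY NAME together with leaf-03's shape `B13TermOpEnvelope.ActOpLineAnalyticOn`
p214457 and the owner's `OutputRateActOpFibre.ActOpFibre` p213673; a FOLLOWER of this lineage's `B13StepOfRecordSecantStructural` p214566 —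
applications in a new module, nobody's file edited).  Summits-side NEW WORK under the LEAN
PLACEMENT RULE (cell bookkeeping; NOT a Literature module).  HONEST FRAMING: rung (B)+1 of the FINITE-VOLUME T⁴ continuum programme —
NOT infinite volume, NOT a mass gap, NOT the Clay problem, and **NOT A PROOF OF NE5, NOR OF W2-op**: the operator half of W2 stays
RELOCATED (to factor-level line analyticity on the class, [analysis], NOT PRINTED — KIND [Balaban1988RG2Cluster] (2.14) p. 15 ∕
(2.16)–(2.17) p. 16 — resp. to the owner's (H-rep) dictionary + margin one level down), NOT discharged; every other analytic input of the
END is a DISPLAYED HYPOTHESIS exactly as in `B13StepOfRecordSecantStructural`.  HONEST DEPENDENCY (cell line, verbatim): continuum YM on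
T⁴ ⇐ BetaPertH ∧ nine spine estimates (0/9 proved); BetaPertH ⇐ (D1) ∧ (D4) ∧ CAP+tail; G-an2-4 gates asym, D1 and NE2/3/4.

WHAT THIS FILE DOES.
* §1 **`ne5_of_record_secant_lineAnalytic`** — `B13StepOfRecordSecantStructural.ne5_of_record_secant_structural` with
  `hfib := B13StepEnvelopeEnd.actOpFibre_of_actOpLineAnalyticOn ((assembly S).boxInClass … hOp′ hHist′) hAK hact` (leaf-03's bridge: slack +
  norm majorant + factor line analyticity on the class ⟹ the owner's fibre shape, the segment `p.1 + ζ•u` lying in `box ⊆ class` by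
  `opSegment_mem_box`): the secant END OF RECORD whose operator-side
  [analysis] binder is **`hact : ActOpLineAnalyticOn (labelsIndexing …) S.act (ballClass (selfCtr (assembly S).raw (assembly S).histRef) ROp
  RHist) W` — VERBATIM the operator binder of leaf-03's Cauchy END E9[rec] (`B13StepEnvelopeEnd`, INTENT l.10227)** — plus the factor norm
  majorant `hAK` on that class by `Aop` and E1∕E9's ROOM `rOp ≤ ROp`, `bHist + rHist ≤ RHist`; conclusion LITERALLY
  `NE5 (outA S E₀ cB) (outB S E₀ cB) W κ θ′ C₅` with the structural END's constant (`N̄op := 1∕(1 − ρ₀)`).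
* §2 **`exists_ne5_of_record_secant_lineAnalytic_readAt`** — the same at leaf-03's read-at packages with `k₀`, `B` eliminated.
CENSUS VALUE (numbers, not adjectives): after this module the two END faces of record that take W2-op at FACTOR level — E8[rec] (secant,
this lineage) and E9[rec] (Cauchy, leaf-03) — read ONE common operator-side binder `hact`; they differ only in the history side (secant
moduli `N ≤ N̄` + absolute majorant vs. structure `ActExpLinearOn` + norm majorant) and in the constants.  Nothing of [II] is asserted;
0 sorry; axioms ⊆ {propext, Classical.choice, Quot.sound}.
-/

noncomputable section

open scoped BigOperators
open Metric Set MeasureTheory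

namespace Summit.QuantumFields.BalabanUV.T4Continuum.B13StepOfRecordSecantLine

open Literature.MathematicalPhysics.QuantumFieldTheory.Balaban1983to89
open Literature.MathematicalPhysics.QuantumFieldTheory.Balaban1983to89.T4OutputRate (Carriers DecayBound NE5)
open Literature.MathematicalPhysics.QuantumFieldTheory.Balaban1983to89.T4InputCauchyRateData (StepModel)
open Literature.MathematicalPhysics.QuantumFieldTheory.Balaban1983to89.T4InputCauchyRateSpecies (ballClass OpLipschitz)
open Summit.QuantumFields.BalabanUV.T4Continuum.B13Carriers (TwoRuns)
open Summit.QuantumFields.BalabanUV.T4Continuum.B13OpDatum (OpDatum)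
open Summit.QuantumFields.BalabanUV.T4Continuum.B13OpDatumJunctions (RawBounded WeightedEntrywiseRate)
open Summit.QuantumFields.BalabanUV.T4Continuum.B13StepTermLabels (InnerLabel)
open Summit.QuantumFields.BalabanUV.T4Continuum.B13StepTermFamily (TermIndexing ActData ActExpLinearOn out)
open Summit.QuantumFields.BalabanUV.T4Continuum.B13StepTermSocket (labelsIndexing touchInc)
open Summit.QuantumFields.BalabanUV.T4Continuum.B13InnerData (Bnd b13InnerData)
open Summit.QuantumFields.BalabanUV.T4Continuum.B13Base (selfCtr)
open Summit.QuantumFields.BalabanUV.T4Continuum.B13Represents (Assembly)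
open Summit.QuantumFields.BalabanUV.T4Continuum.UrsellTermBudget (actSum)
open Summit.QuantumFields.BalabanUV.T4Continuum.B13TermHistSecant (ActExpNormBound ActAbsBound)
open Summit.QuantumFields.BalabanUV.T4Continuum.B13DomainGeometryTR (domainGeometry)
open Summit.QuantumFields.BalabanUV.T4Continuum.B13StepOfRecord (Slots assembly step outA outB)
open Summit.QuantumFields.BalabanUV.T4Continuum.B13StepOfRecordReadAt (readAtSlots)
open Summit.QuantumFields.BalabanUV.T4Continuum.OutputRateActOpFibre (ActOpFibre)
open Summit.QuantumFields.BalabanUV.T4Continuum.OutputRateInsertionStructural (InsOpComposition)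
open Summit.QuantumFields.BalabanUV.T4Continuum.B13TermOpEnvelope (ActOpLineAnalyticOn)
open Summit.QuantumFields.BalabanUV.T4Continuum.B13StepEnvelopeEnd (actOpFibre_of_actOpLineAnalyticOn)
open Summit.QuantumFields.BalabanUV.T4Continuum.B13StepOfRecordSecantStructural (ne5_of_record_secant_structural
  exists_ne5_of_record_secant_structural_readAt)

/-! ## §1 The secant END of record from the Cauchy route's operator-side binder -/

section OfRecord

variable {𝔾 : Type} [GaugeGroup 𝔾] {R : TwoRuns 𝔾} {E IOp Hist Ω : Type*} [NormedAddCommGroup Hist] [NormedSpace ℂ Hist]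
  [CompleteSpace Hist] [NormedAddCommGroup IOp] [NormedSpace ℂ IOp] [MeasurableSpace Ω] (S : Slots R E IOp Hist) (E₀ cB : ℝ)

/-- [folklore] **E8[rec] WITH LEAF-03's OPERATOR-SIDE BINDER.**  `B13StepOfRecordSecantStructural.ne5_of_record_secant_structural` with its
fibre shape PRODUCED by leaf-03's bridge `actOpFibre_of_actOpLineAnalyticOn` from: E1∕E9's ROOM `rOp ≤ ROp`, `bHist + rHist ≤ RHist` (⟹ slack by leaf-09's `Assembly.boxInClass`), leaf-03's
`hact : ActOpLineAnalyticOn (labelsIndexing …) S.act (ballClass (selfCtr (assembly S).raw (assembly S).histRef) ROp RHist) W` (VERBATIM the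
operator binder of the Cauchy END E9[rec]) and the factor norm majorant `hAK` on that class by `Aop` ((2.38) KIND).  Every other binder as
in the structural END (insertion COMPOSITION shape + membership + NE2-type rate; W3 ×2; L05∕L06; W1 entry data; structure `ActExpLinearOn`,
`0 ≤ N ≤ N̄`, `ActAbsBound` + decay splits + (2.38) shapes ×2; radii; numerics).  Conclusion LITERALLY `NE5 (outA S E₀ cB) (outB S E₀ cB) W
κ θ′ C₅`.  NOT a proof of NE5; W2-op RELOCATED to factor-level line analyticity, NOT discharged. -/
theorem ne5_of_record_secant_lineAnalytic {W : Set (ℕ → ℝ)} {ROp RHist : ℕ → ℝ}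
    {N A A' Aop Aop' : ℕ → (ℕ → ℝ) → R.carriers.BgB → R.carriers.Dom → InnerLabel R.carriers.Dom (Bnd R) → ℝ}
    {Dt : ActData R.carriers.Dom (InnerLabel R.carriers.Dom (Bnd R)) (OpDatum E) Hist Ω}
    {κ Nbar ε εop Rt EA₀ E₁ cA c₁ r₀ Gi δI ρ₁ θ θ' ρ₀ B : ℝ} {k₀ k₁ : ℕ} (rI : ℕ → ℝ) (hrI : ∀ k, 0 < rI k)
    {Cfg : ℕ → Type*} [∀ k, NormedAddCommGroup (Cfg k)] [∀ k, NormedSpace ℂ (Cfg k)] {cfg : ∀ k, IOp → Cfg k}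
    {Φ : ∀ k, (R.carriers.Dom → ℝ) → Cfg k → Hist} {𝒪 : ℕ → (ℕ → ℝ) → R.carriers.BgB → Set IOp}
    {Dc : ∀ k, (ℕ → ℝ) → R.carriers.BgB → Set (Cfg k)}
    (hT : (assembly S).TransportReads W)
    (hbB : (assembly S).SliceBudgetB W κ cB) (hbA : S.D.SliceBudget (step S E₀ cB) W κ cA)
    (hdA : DecayBound (outA S E₀ cB) W EA₀ κ) (hdB : DecayBound (outB S E₀ cB) W E₀ κ)
    (hRA : RawBounded S.F (assembly S).rawAt W) (hRB : RawBounded S.F S.rawB W)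
    (hwer : WeightedEntrywiseRate S.F (assembly S).rawAt S.rawB W c₁ fun k => θ ^ k) (hfl : ∀ k, r₀ ≤ S.rOp k)
    (hcomp : InsOpComposition (S.D.toInsOpModel (step S E₀ cB) rI hrI) W κ E₀ Gi cfg Φ 𝒪 Dc)
    (hIA : ∀ k, ∀ g ∈ W, ∀ (U : R.carriers.BgB), (S.D.toInsOpModel (step S E₀ cB) rI hrI).opIA g U k ∈ 𝒪 k g U)
    (hirate : (S.D.toInsOpModel (step S E₀ cB) rI hrI).InsOpRate W δI θ) (hδI : 0 ≤ δI) (hGi : 0 ≤ Gi) (hρ₁ : ρ₁ < 1)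
    (hreachI : δI * θ ^ k₁ ≤ ρ₁)
    (hOp' : ∀ k, S.rOp k ≤ ROp k) (hHist' : ∀ k, (assembly S).bHist E₀ cB k + S.rHist k ≤ RHist k)
    (hact : ActOpLineAnalyticOn (labelsIndexing (domainGeometry R) (b13InnerData R)) S.act
      (ballClass (selfCtr (assembly S).raw (assembly S).histRef) ROp RHist) W)
    (hAK : ∀ k, ∀ g ∈ W, ∀ (U : R.carriers.BgB) (q : OpDatum E × Hist),
      q ∈ ballClass (selfCtr (assembly S).raw (assembly S).histRef) ROp RHist k g U → ∀ X : R.carriers.Dom, R.carriers.scale X = k →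
        ∀ i, (labelsIndexing (domainGeometry R) (b13InnerData R)).Rel k i X → ∀ m,
          ‖S.act ((labelsIndexing (domainGeometry R) (b13InnerData R)).poly i m)
              ((labelsIndexing (domainGeometry R) (b13InnerData R)).lab i m) q.1 q.2‖ ≤
            Aop k g U ((labelsIndexing (domainGeometry R) (b13InnerData R)).poly i m)
              ((labelsIndexing (domainGeometry R) (b13InnerData R)).lab i m))
    (hAop0 : ∀ k g U Z ℓ, 0 ≤ Aop k g U Z ℓ) (hAop0' : ∀ k g U Z ℓ, 0 ≤ Aop' k g U Z ℓ)
    (hdecop : ∀ k g U Z ℓ, Aop k g U Z ℓ ≤ Aop' k g U Z ℓ * Real.exp (-(κ * (R.carriers.d Z + 5)))) (hεop : 0 ≤ εop)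
    (h238op : ∀ k, ∀ g ∈ W, ∀ (U : R.carriers.BgB), ∀ Z ∈ R.domAt k,
      actSum (b13InnerData R) (Aop' k g U) k Z ≤ εop * Real.exp (-(Rt * R.carriers.d Z)))
    (hΦopsmall : 36 * (εop * Real.exp 64 * B12TreeDecay.K₀ (4 * 2 ^ 4) (2 * 4)) < 1)
    (hexp : ActExpLinearOn (labelsIndexing (domainGeometry R) (b13InnerData R)) S.act Dt
      (ballClass (selfCtr (assembly S).raw (assembly S).histRef) ROp RHist) W)
    (hN : ActExpNormBound (labelsIndexing (domainGeometry R) (b13InnerData R)) Dt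
      (ballClass (selfCtr (assembly S).raw (assembly S).histRef) ROp RHist) W S.rHist N)
    (hN0 : ∀ k g U Z ℓ, 0 ≤ N k g U Z ℓ) (hNle : ∀ k g U Z ℓ, N k g U Z ℓ ≤ Nbar) (hNbar : 0 ≤ Nbar)
    (habs : ActAbsBound (labelsIndexing (domainGeometry R) (b13InnerData R)) Dt
      (ballClass (selfCtr (assembly S).raw (assembly S).histRef) ROp RHist) W A)
    (hA0 : ∀ k g U Z ℓ, 0 ≤ A k g U Z ℓ) (hA0' : ∀ k g U Z ℓ, 0 ≤ A' k g U Z ℓ) (hκ : 0 ≤ κ)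
    (hdec : ∀ k g U Z ℓ, A k g U Z ℓ ≤ A' k g U Z ℓ * Real.exp (-(κ * (R.carriers.d Z + 5))))
    (hε : 0 ≤ ε)
    (h238 : ∀ k, ∀ g ∈ W, ∀ (U : R.carriers.BgB), ∀ Z ∈ R.domAt k,
      actSum (b13InnerData R) (A' k g U) k Z ≤ ε * Real.exp (-(Rt * R.carriers.d Z)))
    (hRt : 64 * Real.log 162 + 64 ≤ Rt) (hΦsmall : 36 * (ε * Real.exp 64 * B12TreeDecay.K₀ (4 * 2 ^ 4) (2 * 4)) < 1)
    (hOp : ∀ k, c₁ / r₀ * S.rOp k ≤ ROp k) (hHist : ∀ k, (assembly S).bHist E₀ cB k ≤ RHist k)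
    (hHistA : ∀ k, (Gi * δI / (1 - ρ₁) + 2 * Gi / θ ^ k₁) * S.rHist k + EA₀ * (S.rHist k * (cA / (1 - S.D.ω))) ≤ RHist k)
    (hEA₀ : 0 ≤ EA₀) (hE₀ : 0 ≤ E₀) (hE₁ : 0 < E₁) (hcA : 0 ≤ cA) (hcB : 0 ≤ cB)
    (hc₁ : 0 ≤ c₁) (hr₀ : 0 < r₀) (hθ0 : 0 < θ) (hθθ' : θ ≤ θ') (hθ'1 : θ' ≤ 1) (hω : 0 < S.D.ω)
    (hω1 : S.D.ω < 1) (hρ₀ : 0 ≤ ρ₀) (hρ₀1 : ρ₀ < 1) (hreach : c₁ / r₀ * θ ^ k₀ ≤ ρ₀) (hB : 0 ≤ B) (hfirst : ∀ k < k₀, EA₀ + E₀ ≤ B * θ ^ k)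
    (hsmall : S.D.ω + 2 * (Nbar * ((ε * Real.exp 64 * B12TreeDecay.K₀ (4 * 2 ^ 4) (2 * 4)) /
          (1 - 36 * (ε * Real.exp 64 * B12TreeDecay.K₀ (4 * 2 ^ 4) (2 * 4))) ^ 2)) * cA < θ') :
    NE5 (outA S E₀ cB) (outB S E₀ cB) W κ θ'
      (((1 / (1 - ρ₀) * ((εop * Real.exp 64 * B12TreeDecay.K₀ (4 * 2 ^ 4) (2 * 4)) /
          (1 - 36 * (εop * Real.exp 64 * B12TreeDecay.K₀ (4 * 2 ^ 4) (2 * 4))) ^ 2)) * (c₁ / r₀) + 2 * (Nbar * ((ε * Real.exp 64 * B12TreeDecay.K₀ (4 * 2 ^ 4) (2 * 4)) /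
          (1 - 36 * (ε * Real.exp 64 * B12TreeDecay.K₀ (4 * 2 ^ 4) (2 * 4))) ^ 2)) *
          (Gi * δI / (1 - ρ₁) + 2 * Gi / θ ^ k₁) + B) * (θ' - S.D.ω) /
        (θ' - (S.D.ω + 2 * (Nbar * ((ε * Real.exp 64 * B12TreeDecay.K₀ (4 * 2 ^ 4) (2 * 4)) /
          (1 - 36 * (ε * Real.exp 64 * B12TreeDecay.K₀ (4 * 2 ^ 4) (2 * 4))) ^ 2)) * cA))) :=
  ne5_of_record_secant_structural S E₀ cB rI hrI hT hbB hbA hdA hdB hRA hRB hwer hfl hcomp hIA hirate hδI hGi hρ₁ hreachI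
    (actOpFibre_of_actOpLineAnalyticOn ((assembly S).boxInClass ((assembly S).bHist E₀ cB) W hOp' hHist') hAK hact) hAop0 hAop0' hdecop
    hεop h238op hΦopsmall hexp hN hN0 hNle hNbar habs hA0 hA0' hκ hdec hε h238 hRt hΦsmall hOp hHist hHistA hEA₀ hE₀ hE₁ hcA hcB hc₁
    hr₀ hθ0 hθθ' hθ'1 hω hω1 hρ₀ hρ₀1 hreach hB hfirst hsmall

/-! ## §2 The read-at face with leaf L10's letters eliminated -/

/-- [folklore] **THE MOST REDUCED SECANT FACE OF RECORD FROM THE CAUCHY ROUTE's OPERATOR BINDER**: §1 at the read-at slot packages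
`readAtSlots S ι` (reading by construction) with `k₀`, `B` eliminated (`0 < θ < 1`, `0 < ρ₀ < 1`):
`∃ C₅, NE5 (outA (readAtSlots S ι) E₀ cB) (outB (readAtSlots S ι) E₀ cB) W κ θ′ C₅`. -/
theorem exists_ne5_of_record_secant_lineAnalytic_readAt (ι : (ℕ → ℝ) → R.carriers.BgA → ℕ → IOp) {W : Set (ℕ → ℝ)}
    {ROp RHist : ℕ → ℝ} {N A A' Aop Aop' : ℕ → (ℕ → ℝ) → R.carriers.BgB → R.carriers.Dom → InnerLabel R.carriers.Dom (Bnd R) → ℝ}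
    {Dt : ActData R.carriers.Dom (InnerLabel R.carriers.Dom (Bnd R)) (OpDatum E) Hist Ω}
    {κ Nbar ε εop Rt EA₀ cA c₁ r₀ Gi δI ρ₁ θ θ' ρ₀ : ℝ} {k₁ : ℕ} (rI : ℕ → ℝ) (hrI : ∀ k, 0 < rI k)
    {Cfg : ℕ → Type*} [∀ k, NormedAddCommGroup (Cfg k)] [∀ k, NormedSpace ℂ (Cfg k)] {cfg : ∀ k, IOp → Cfg k}
    {Φ : ∀ k, (R.carriers.Dom → ℝ) → Cfg k → Hist} {𝒪 : ℕ → (ℕ → ℝ) → R.carriers.BgB → Set IOp}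
    {Dc : ∀ k, (ℕ → ℝ) → R.carriers.BgB → Set (Cfg k)}
    (hbB : (assembly (readAtSlots S ι)).SliceBudgetB W κ cB)
    (hbA : (readAtSlots S ι).D.SliceBudget (step (readAtSlots S ι) E₀ cB) W κ cA)
    (hdA : DecayBound (outA (readAtSlots S ι) E₀ cB) W EA₀ κ) (hdB : DecayBound (outB (readAtSlots S ι) E₀ cB) W E₀ κ)
    (hRA : RawBounded S.F (assembly (readAtSlots S ι)).rawAt W) (hRB : RawBounded S.F S.rawB W)
    (hwer : WeightedEntrywiseRate S.F (assembly (readAtSlots S ι)).rawAt S.rawB W c₁ fun k => θ ^ k) (hfl : ∀ k, r₀ ≤ S.rOp k)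
    (hcomp : InsOpComposition ((readAtSlots S ι).D.toInsOpModel (step (readAtSlots S ι) E₀ cB) rI hrI) W κ E₀ Gi cfg Φ 𝒪 Dc)
    (hIA : ∀ k, ∀ g ∈ W, ∀ (U : R.carriers.BgB), ((readAtSlots S ι).D.toInsOpModel (step (readAtSlots S ι) E₀ cB) rI hrI).opIA g U k ∈ 𝒪 k g U)
    (hirate : ((readAtSlots S ι).D.toInsOpModel (step (readAtSlots S ι) E₀ cB) rI hrI).InsOpRate W δI θ) (hδI : 0 ≤ δI)
    (hGi : 0 ≤ Gi) (hρ₁ : ρ₁ < 1) (hreachI : δI * θ ^ k₁ ≤ ρ₁)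
    (hOp' : ∀ k, S.rOp k ≤ ROp k) (hHist' : ∀ k, (assembly S).bHist E₀ cB k + S.rHist k ≤ RHist k)
    (hact : ActOpLineAnalyticOn (labelsIndexing (domainGeometry R) (b13InnerData R)) S.act
      (ballClass (selfCtr (assembly (readAtSlots S ι)).raw (assembly (readAtSlots S ι)).histRef) ROp RHist) W)
    (hAK : ∀ k, ∀ g ∈ W, ∀ (U : R.carriers.BgB) (q : OpDatum E × Hist),
      q ∈ ballClass (selfCtr (assembly (readAtSlots S ι)).raw (assembly (readAtSlots S ι)).histRef) ROp RHist k g U →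
        ∀ X : R.carriers.Dom, R.carriers.scale X = k → ∀ i, (labelsIndexing (domainGeometry R) (b13InnerData R)).Rel k i X → ∀ m,
          ‖S.act ((labelsIndexing (domainGeometry R) (b13InnerData R)).poly i m)
              ((labelsIndexing (domainGeometry R) (b13InnerData R)).lab i m) q.1 q.2‖ ≤
            Aop k g U ((labelsIndexing (domainGeometry R) (b13InnerData R)).poly i m)
              ((labelsIndexing (domainGeometry R) (b13InnerData R)).lab i m))
    (hAop0 : ∀ k g U Z ℓ, 0 ≤ Aop k g U Z ℓ) (hAop0' : ∀ k g U Z ℓ, 0 ≤ Aop' k g U Z ℓ)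
    (hdecop : ∀ k g U Z ℓ, Aop k g U Z ℓ ≤ Aop' k g U Z ℓ * Real.exp (-(κ * (R.carriers.d Z + 5)))) (hεop : 0 ≤ εop)
    (h238op : ∀ k, ∀ g ∈ W, ∀ (U : R.carriers.BgB), ∀ Z ∈ R.domAt k,
      actSum (b13InnerData R) (Aop' k g U) k Z ≤ εop * Real.exp (-(Rt * R.carriers.d Z)))
    (hΦopsmall : 36 * (εop * Real.exp 64 * B12TreeDecay.K₀ (4 * 2 ^ 4) (2 * 4)) < 1)
    (hexp : ActExpLinearOn (labelsIndexing (domainGeometry R) (b13InnerData R)) S.act Dt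
      (ballClass (selfCtr (assembly (readAtSlots S ι)).raw (assembly (readAtSlots S ι)).histRef) ROp RHist) W)
    (hN : ActExpNormBound (labelsIndexing (domainGeometry R) (b13InnerData R)) Dt
      (ballClass (selfCtr (assembly (readAtSlots S ι)).raw (assembly (readAtSlots S ι)).histRef) ROp RHist) W S.rHist N)
    (hN0 : ∀ k g U Z ℓ, 0 ≤ N k g U Z ℓ) (hNle : ∀ k g U Z ℓ, N k g U Z ℓ ≤ Nbar) (hNbar : 0 ≤ Nbar)
    (habs : ActAbsBound (labelsIndexing (domainGeometry R) (b13InnerData R)) Dt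
      (ballClass (selfCtr (assembly (readAtSlots S ι)).raw (assembly (readAtSlots S ι)).histRef) ROp RHist) W A)
    (hA0 : ∀ k g U Z ℓ, 0 ≤ A k g U Z ℓ) (hA0' : ∀ k g U Z ℓ, 0 ≤ A' k g U Z ℓ) (hκ : 0 ≤ κ)
    (hdec : ∀ k g U Z ℓ, A k g U Z ℓ ≤ A' k g U Z ℓ * Real.exp (-(κ * (R.carriers.d Z + 5))))
    (hε : 0 ≤ ε)
    (h238 : ∀ k, ∀ g ∈ W, ∀ (U : R.carriers.BgB), ∀ Z ∈ R.domAt k,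
      actSum (b13InnerData R) (A' k g U) k Z ≤ ε * Real.exp (-(Rt * R.carriers.d Z)))
    (hRt : 64 * Real.log 162 + 64 ≤ Rt) (hΦsmall : 36 * (ε * Real.exp 64 * B12TreeDecay.K₀ (4 * 2 ^ 4) (2 * 4)) < 1)
    (hOp : ∀ k, c₁ / r₀ * S.rOp k ≤ ROp k) (hHist : ∀ k, (assembly S).bHist E₀ cB k ≤ RHist k)
    (hHistA : ∀ k, (Gi * δI / (1 - ρ₁) + 2 * Gi / θ ^ k₁) * S.rHist k + EA₀ * (S.rHist k * (cA / (1 - S.D.ω))) ≤ RHist k)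
    (hEA₀ : 0 ≤ EA₀) (hE₀ : 0 ≤ E₀) (hcA : 0 ≤ cA) (hcB : 0 ≤ cB)
    (hc₁ : 0 ≤ c₁) (hr₀ : 0 < r₀) (hθ0 : 0 < θ) (hθ1 : θ < 1) (hθθ' : θ ≤ θ') (hθ'1 : θ' ≤ 1) (hω : 0 < S.D.ω)
    (hω1 : S.D.ω < 1) (hρ₀ : 0 < ρ₀) (hρ₀1 : ρ₀ < 1)
    (hsmall : S.D.ω + 2 * (Nbar * ((ε * Real.exp 64 * B12TreeDecay.K₀ (4 * 2 ^ 4) (2 * 4)) /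
          (1 - 36 * (ε * Real.exp 64 * B12TreeDecay.K₀ (4 * 2 ^ 4) (2 * 4))) ^ 2)) * cA < θ') :
    ∃ C₅, NE5 (outA (readAtSlots S ι) E₀ cB) (outB (readAtSlots S ι) E₀ cB) W κ θ' C₅ :=
  exists_ne5_of_record_secant_structural_readAt S E₀ cB ι rI hrI hbB hbA hdA hdB hRA hRB hwer hfl hcomp hIA hirate hδI hGi hρ₁ hreachI
    (actOpFibre_of_actOpLineAnalyticOn ((assembly (readAtSlots S ι)).boxInClass ((assembly (readAtSlots S ι)).bHist E₀ cB) W hOp'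
      hHist') hAK hact) hAop0 hAop0' hdecop hεop h238op hΦopsmall hexp hN hN0 hNle hNbar habs hA0 hA0' hκ hdec hε h238 hRt hΦsmall hOp hHist
    hHistA hEA₀ hE₀ hcA hcB hc₁ hr₀ hθ0 hθ1 hθθ' hθ'1 hω hω1 hρ₀ hρ₀1 hsmall

end OfRecord

end Summit.QuantumFields.BalabanUV.T4Continuum.B13StepOfRecordSecantLine

end
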